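import Literature.NumberTheory.EllipticCurves.LangHeightSzpiroRatio
import Literature.NumberTheory.EllipticCurves.NeronLocalHeight
import HarnessLib

/-!
# Petsche's local height–discriminant sums: the two local estimates behind Proposition 7

Topic `NumberTheory/EllipticCurves` (family `abc`, G06). Next layer of the decomposition of the
named fact `Literature.NumberTheory.EllipticCurves.szpiro_imp_langHeightLowerBoundConjecture`
(Szpiro ⇒ Lang's height lower bound over `ℚ`; Hindry–Silverman 1988, Thm. 0.3), below
`Literature.NumberTheory.EllipticCurves.Petsche2006_card_smallPoints_le` (Petsche 2006, Prop. 7: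
the bound on the number of small rational points), whose printed proof (New York J. Math. 12 (2006),
pp. 263–265; arXiv math/0508160, pp. 5–7) estimates the **height–discriminant sum**
`Λ(Z) = N⁻² Σ_{i,j} ĥ(P_i − P_j)` of `N` distinct small points from above by the parallelogram law
and from below place by place, `Λ(Z) = Σ_v (d_v/d) Λ_v(Z)` with
`Λ_v(Z) = N⁻² Σ_{i ≠ j} λ_v(P_i − P_j)` (Petsche, display (7)) and `λ_v` the Néron local height
functions (`WeierstrassCurve.Affine.Point.neronLocalHeight`, file `NeronLocalHeight.lean`).

This file defines `Λ_v(Z)` (`Petsche2006.localHeightDiscSum`) and vendors, over the ground field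
`k = ℚ` (`d = 1`, all `d_v = 1`, a single archimedean place), the two *local* estimates of that
proof as named facts (D-0014):

* `Petsche2006_le_finsum_localHeightDiscSum` — the non-archimedean estimate (Petsche, proof of
  Prop. 7, the display following "we will show that", arXiv p. 6 / journal p. 264):
  `Σ_{v ∈ M_ℚ⁰} Λ_v(Z) ≥ (1/12)(1/(16σ²) − 1/N) log N(𝔇_{E/ℚ})`, obtained there from Lemma 3
  (a variant of Hindry–Silverman, *On Lehmer's conjecture for elliptic curves*, Prop. 1.2: Tate
  uniformisation, `E₀ = ker r`, positivity of the Fourier coefficients of `B₂`) summed over the bad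
  places, Ogg's formula and Jensen's inequality;
* `Petsche2006_exists_subset_le_neronLocalHeight_real` — the archimedean step (loc. cit., the
  paragraph "Divide the torus `ℂ/L` into the `24²` parallelograms …"): by the pigeonhole principle
  and Lemma 5 (Hindry–Silverman, C. R. Acad. Sci. 329 (1999), Lemma 1; Invent. Math. 93 (1988),
  Prop. 2.3), any `24²·N + 1` rational points contain `N + 1` points all of whose differences have
  `λ_∞ ≥ (1/288) max{1, log |j_E|}`.

The sibling proof file `LangHeightSmallPointsProofs.lean` proves Proposition 7 over `ℚ` from these
two facts and the local decomposition `ĥ = 2(λ_∞ + Σ_p λ_p)`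
(`WeierstrassCurve.Affine.Point.canonicalHeight_eq_two_mul_sum_neronLocalHeight`, ATAEC VI.2.1),
and hence the target fact from these three local-height statements.

## Design choices

* `localHeightDiscSum v Z` is Petsche's display (7) literally: `Z` is a `Finset` of points (so its
  elements are distinct, `N = Z.card`), the double sum runs over ordered pairs `P ≠ Q`
  (`Q ∈ Z.erase P`), for any absolute value `v` on any field `K` (`[DecidableEq K]` is taken as a
  parameter so that over `ℚ` the group law is elaborated with `ℚ`'s own decidable equality, as in
  `LangHeightEC.lean` and `LangHeightSzpiroRatio.lean`). For `Z = ∅` it is the junk value `0`.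
* Over `ℚ` the places are indexed as in `NeronLocalHeight.lean`: the real place
  `Rat.AbsoluteValue.real` and `Rat.HeightOneSpectrum.padicAbv v`, `v : HeightOneSpectrum ℤ`; the sum
  over the finite places is a `finsum` (finitely supported by ATAEC VI.2.1 / Lemma VI.2.2; the fact
  below does not assert this finiteness, which the proof file takes from the decomposition fact).
* Both facts are stated for **arbitrary** finite sets of distinct rational points: Lemma 3 is printed
  for "a set of `N` distinct `k_v`-rational points", the Jensen step (displays (28)–(30) of the arXiv
  version) involves only `E`, and the pigeonhole/Lemma 5 paragraph uses only `|S| ≥ 24²(N−1)+1`;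
  smallness of the points enters Petsche's proof only through the parallelogram-law upper bound,
  which is proved (not assumed) in the sibling proof file.
* `|j_E|_{v₀}` for the unique archimedean place of `ℚ` is `|(W.j : ℚ)|` (Mathlib `WeierstrassCurve.j`),
  cast to `ℝ`; `σ = W.szpiroRatio ℤ`, `N(𝔇_{E/ℚ}) = W.minimalDiscriminantNorm ℤ` as in
  `LangHeightSzpiroRatio.lean` (all three are isomorphism invariants, so quantifying over every
  elliptic Weierstrass equation `W` over `ℚ` is faithful; `λ_v` does not depend on the equation either,
  ATAEC VI.1.1(b)).
* Mathlib / tree search: no `localHeightDiscSum`, discrepancy or "small points" declarations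
  (`lean search 'DiscSum|smallPoints|Petsche'`: only `LangHeightSzpiroRatio.lean`).

## References

* C. Petsche, *Small rational points on elliptic curves over number fields*, New York J. Math. 12
  (2006), 257–268; arXiv math/0508160: displays (6), (7), Lemma 3, Lemma 5, Proposition 7 and its
  proof.
* M. Hindry, J. H. Silverman, *The canonical height and integral points on elliptic curves*,
  Invent. Math. 93 (1988), 419–450, Prop. 2.3, Thm. 0.3; *Sur le nombre de points de torsion
  rationnels sur une courbe elliptique*, C. R. Acad. Sci. Paris 329 (1999), 97–100, Lemme 1;
  *On Lehmer's conjecture for elliptic curves*, Sém. Théorie des Nombres Paris 1988–89, Prop. 1.2.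
* J. H. Silverman, *Advanced Topics in the Arithmetic of Elliptic Curves*, GTM 151 (1994), Thm. VI.1.1,
  Thm. VI.2.1, Thm. VI.3.4, Thm. VI.4.1.
-/

noncomputable section

open scoped Classical

open IsDedekindDomain

namespace Literature.NumberTheory.EllipticCurves

/-! ### Petsche's local height–discriminant sum `Λ_v(Z)` -/

namespace Petsche2006

section Defs

variable {K : Type*} [Field K] [DecidableEq K] (v : AbsoluteValue K ℝ) {W : WeierstrassCurve K}

/-- Petsche's **local height–discriminant sum** of a finite set `Z = {P₁, …, P_N}` of `N` distinct
points at the absolute value `v` (Petsche 2006, display (7)):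
`Λ_v(Z) = N⁻² Σ_{1 ≤ i, j ≤ N, i ≠ j} λ_v(P_i − P_j)`, with `λ_v` the Néron local height function
(`WeierstrassCurve.Affine.Point.neronLocalHeight v`). The sum runs over ordered pairs of distinct
elements of `Z`; for `Z = ∅` the value is `0`. [cite: Petsche2006, (7)] -/
def localHeightDiscSum (Z : Finset W.toAffine.Point) : ℝ :=
  1 / (Z.card : ℝ) ^ 2 * ∑ P ∈ Z, ∑ Q ∈ Z.erase P, (P - Q).neronLocalHeight v

/-- Unfolding lemma for `localHeightDiscSum` (Petsche 2006, display (7)). [folklore] -/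
theorem localHeightDiscSum_def (Z : Finset W.toAffine.Point) :
    localHeightDiscSum v Z =
      1 / (Z.card : ℝ) ^ 2 * ∑ P ∈ Z, ∑ Q ∈ Z.erase P, (P - Q).neronLocalHeight v := rfl

/-- `Λ_v(∅) = 0`. [folklore] -/
@[simp]
theorem localHeightDiscSum_empty : localHeightDiscSum v (∅ : Finset W.toAffine.Point) = 0 := by
  simp [localHeightDiscSum]

/-- `N² Λ_v(Z) = Σ_{i ≠ j} λ_v(P_i − P_j)` for non-empty `Z` (`N = |Z|`). [folklore] -/
theorem card_sq_mul_localHeightDiscSum {Z : Finset W.toAffine.Point} (hZ : Z.Nonempty) :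
    (Z.card : ℝ) ^ 2 * localHeightDiscSum v Z =
      ∑ P ∈ Z, ∑ Q ∈ Z.erase P, (P - Q).neronLocalHeight v := by
  have hN : (Z.card : ℝ) ≠ 0 := by exact_mod_cast hZ.card_pos.ne'
  rw [localHeightDiscSum, ← mul_assoc, mul_one_div_cancel (pow_ne_zero 2 hN), one_mul]

/-- For two distinct points, `Λ_v({P, Q}) = ¼ (λ_v(P − Q) + λ_v(Q − P)) = ½ λ_v(P − Q)`
(`λ_v` is even). [folklore] -/
theorem localHeightDiscSum_pair {P Q : W.toAffine.Point} (h : P ≠ Q) :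
    localHeightDiscSum v ({P, Q} : Finset W.toAffine.Point) = 1 / 2 * (P - Q).neronLocalHeight v := by
  have hQ : Q - P = -(P - Q) := (neg_sub P Q).symm
  rw [localHeightDiscSum, Finset.card_pair h, Finset.sum_pair h, Finset.erase_insert (by simpa using h),
    Finset.sum_singleton, Finset.pair_comm, Finset.erase_insert (by simpa using h.symm),
    Finset.sum_singleton, hQ, WeierstrassCurve.Affine.Point.neronLocalHeight_neg]
  push_cast
  ring

end Defs

end Petsche2006

/-! ### The two local estimates of the proof of Proposition 7, over `ℚ` (named facts) -/

open Petsche2006 Rat.HeightOneSpectrum WeierstrassCurve.Affine.Point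

/-- **Petsche 2006, proof of Proposition 7, the non-archimedean estimate**, ground field `k = ℚ`
(`d = 1`, `d_v = 1`; arXiv math/0508160 p. 6, journal p. 264, the display introduced by "We now
turn to the lower bounds on `Λ_v(Z)` at the non-archimedean places; in particular we will show
that"): *`Σ_{v ∈ M_k⁰} (d_v/d) Λ_v(Z) ≥ (1/12d) (1/(16σ²) − 1/N) log |N(Δ)|`*, where `Z` is a set of
`N ≥ 1` distinct `k`-rational points, `σ` the Szpiro ratio and `Δ = Δ_{E/k}` the minimal
discriminant. Printed proof: Lemma 3 (`Λ_v(Z) ≥ (1/c_v² − 1/N)(1/12) log|1/Δ_v|_v` for any `N`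
distinct points of `E(k_v)`, via Tate's uniformisation and the Fourier expansion of `B₂`), the
identity `d_v log|1/Δ_v|_v = δ_v log N(𝔭_v)`, Ogg's formula `η_v ≤ δ_v`, `η_v²c_v² ≤ 16 δ_v²` and
Jensen's inequality; if `E` has everywhere good reduction both sides are compared with `0`. The
argument uses nothing about `Z` beyond `N = |Z| ≥ 1`, so the fact is stated for every finite
non-empty `Z ⊆ E(ℚ)`. Here `Λ_v = localHeightDiscSum (padicAbv v)`, `σ = W.szpiroRatio ℤ`,
`N(Δ) = W.minimalDiscriminantNorm ℤ`; the sum over the finite places is a `finsum` (finitely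
supported by ATAEC VI.2.1). [cite: Petsche2006, proof of Prop. 7] -/
def Petsche2006_le_finsum_localHeightDiscSum : Prop :=
  ∀ (W : WeierstrassCurve ℚ) [W.IsElliptic] (Z : Finset W.toAffine.Point), Z.Nonempty →
    1 / 12 * (1 / (16 * W.szpiroRatio ℤ ^ 2) - 1 / (Z.card : ℝ)) *
        Real.log (W.minimalDiscriminantNorm ℤ : ℝ) ≤
      ∑ᶠ v : HeightOneSpectrum ℤ, localHeightDiscSum (padicAbv v) Z

/-- **Petsche 2006, proof of Proposition 7, the archimedean step**, ground field `k = ℚ` (arXiv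
math/0508160 p. 6, journal p. 264): *"Divide the torus `ℂ/L` into the `24²` parallelograms
`P_{m₁,m₂} = {z = r₁ + r₂τ | (m₁−1)/24 ≤ r₁ ≤ m₁/24 and (m₂−1)/24 ≤ r₂ ≤ m₂/24}`, `1 ≤ m₁, m₂ ≤ 24`.
By the pigeonhole principle there exists a set `Z = {P₁, …, P_N} ⊆ S` of `N` distinct points such
that `σ(Z)` is contained in one of the `24²` parallelograms"* (for any `S` with
`|S| ≥ 24²(N−1) + 1`) *"… Therefore, by Lemma 5 we have
`λ_{v₀}(P_i − P_j) ≥ (1/288) max{1, log |j_E|_{v₀}}` for all such pairs."* Here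
`σ : E(k) ↪ ℂ/L`, `L = ℤ + τℤ` a normalised lattice with `|j(τ)| = |j_E|_{v₀}`, `λ_{v₀} = λ ∘ σ`
the Néron function (ATAEC VI.3.4), and Lemma 5 is Hindry–Silverman's archimedean estimate
(C. R. Acad. Sci. 329 (1999), Lemme 1; Invent. Math. 93 (1988), Prop. 2.3). Over `ℚ`: `v₀` is the
real place, `λ_{v₀} = neronLocalHeight Rat.AbsoluteValue.real` (Tate's series, ATAEC VI.1.1(c)),
`|j_E|_{v₀} = |W.j|`; with `N − 1 ↦ N` to avoid truncated subtraction.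
[cite: Petsche2006, proof of Prop. 7] -/
def Petsche2006_exists_subset_le_neronLocalHeight_real : Prop :=
  ∀ (W : WeierstrassCurve ℚ) [W.IsElliptic] (S : Finset W.toAffine.Point) (N : ℕ),
    24 ^ 2 * N + 1 ≤ S.card →
      ∃ Z ⊆ S, Z.card = N + 1 ∧ ∀ P ∈ Z, ∀ Q ∈ Z, P ≠ Q →
        1 / 288 * max 1 (Real.log |((W.j : ℚ) : ℝ)|) ≤
          (P - Q).neronLocalHeight Rat.AbsoluteValue.real

end Literature.NumberTheory.EllipticCurves

end
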